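import Summits.BirchSwinnertonDyer.Rank1Residual.X11b.ProcyclicDescent
import HarnessLib

/-!
# X11b, route R1 — procyclic descent, engine (c′): the KERNEL of restriction
# `ker (H¹(G, A) → H¹(H, A)) ≃ A^H/(γ⁻¹ − 1)A^H` for `H = ker(κ : G ↠ ℤ_p)` (towards atom (P11))

HONEST FRAMING (cell `b2b-bsdres`, run/shared/lean/b2b/bsd-rank1-residual/, verbatim in every
file): the goal of the cell is to DELETE the COMBINATION-SHAPED residual classes of the
Birch–Swinnerton-Dyer formula for ALL analytic-rank `≤ 1` elliptic curves over `ℚ` — "full BSD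
formula for every rank `≤ 1` curve in class `C`" assembled STRICTLY from published theorems — so
that the rank-`≤ 1` remainder becomes exactly the CONSTRUCTION-SHAPED classes, which are TYPED
(missing-input `Prop`s), NOT attempted. This is not "finishing BSD". Sub-cell
`b2b-bsdres-multr1-p1` (X11b, route R1 = Castella 2018 Thm. A re-proved along the author's
erratum); a RESEARCH ROUTE; no claim beyond the stated class; X11b stays CONSTRUCTION-SHAPED;
nothing here changes a label; no named fact is minted (two definitions with bodies — the constant
elements of the coinduced module and the endomorphism `γ⁻¹ − 1` of `A^H`; plumbing — and theorems;
no `sorry`).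

## What is here (Greenberg LNM 1716, proof of Lemma 3.3: "`ker(r_v) ≅ H¹(Γ_v, B_v) = B_v/(γ_v − 1)B_v`")

Gen 16's procyclic-descent engine (`CoinducedShift(Exact)`, `ProcyclicDescent`): for a profinite
`G`, a continuous `κ : G ↠ ℤ_p` with `H = ker κ`, `κ(γ) = 1`, and a discrete `p`-primary `G`-module
`A`, the short exact sequence `0 → A →(unit) M_G^H(A) →(S_γ − 1) M_G^H(A) → 0` and the Shapiro map
`sh : H¹(G, M_G^H(A)) ≅ H¹(H, A)` with `sh ∘ H¹(unit) = res` gave (a) `H¹(G, A) ↠ H¹(H, A)^γ` and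
(b) `H²(G, A) = 0 ⟹ H¹(H, A)_γ = 0`.  The SAME long exact sequence, one degree lower, computes the
KERNEL of the restriction — the inflation part of inflation–restriction with `H¹(ℤ_p, B) = B/(γ−1)B`:

* `coe_apply_eq_apply_one_of_mem_invariants`, `smul_apply_one_of_mem_invariants`, `constCoind` —
  **`M_G^H(A)^G = ` the constant functions with value in `A^H`** (Shapiro in degree `0`);
  `tHom_apply_one_of_mem_invariants` — on them `S_γ − 1` is `a ↦ γ⁻¹ • a − a`.
* `resSubgroup_eq_zero_iff_exists_δ₀` — **`ker (res : H¹(G, A) → H¹(H, A)) = im δ₀`**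
  (`sh` injective, `sh ∘ H¹(unit) = res`, exactness at `H¹(G, A)`).
* `subOneFixed` — the endomorphism `a ↦ γ⁻¹ • a − a` of `A^H` (`H` normal); `deltaFixed` — the map
  `A^H → ker res`, `a ↦ δ₀(const a)`; **`deltaFixed_surjective`**, **`deltaFixed_eq_zero_iff`**
  (`δ₀(const a) = 0 ↔ a ∈ (γ⁻¹ − 1) A^H`, exactness at `M^G`);
* **`kerResEquiv : A^H ⧸ (γ⁻¹ − 1)A^H ≃+ ker (H¹(G, A) → H¹(H, A))`** and
  **`natCard_ker_resSubgroup_eq`**.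

Intended use (successor; atom (P11) `LocalKernelOrderAt`, Greenberg Lemma 3.3 at a bad `v ∤ p`): with
`G = D_v`, `κ = κ|_{D_v}` (rescaled, `ProcyclicDescentRescaled`), `A = E[p^∞]`:
`#ker(H¹(K_v, E[p^∞]) → H¹(K_{∞,η}, E[p^∞])) = #(B_v/(γ_v − 1)B_v)` EXACTLY, `B_v = E(K_{∞,η})[p^∞]`
(route p2's `finite_localKer_and_natCard_le` is the inequality `≤`); what then remains of (P11) is
the arithmetic identity `#(B_v/(γ_v − 1)B_v) = c_v^{(p)}` (Néron filtration over the unramified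
tower). No label changes; (P11) itself is NOT discharged here.

References: [GreenbergLNM1716] §3, proof of Lemma 3.3 (p. 87); [SerreGaloisCohomology1997] I §2.2
(exact sequence), I §2.5 Prop. 10 (Shapiro), XIII §1 (`H¹` of a procyclic group);
[JetchevSkinnerWan2017] Prop. 3.3.4 (arXiv:1512.06894 pp. 12–13).
-/

noncomputable section

open CategoryTheory Function
open Literature.NumberTheory.GaloisRepresentations Literature.NumberTheory.EllipticCurves

universe u

namespace Summit.BirchSwinnertonDyer.Rank1Residual.X11b.ProcyclicDescent

/-! ## 1. Invariants of the coinduced module: constant functions with values in `A^H` -/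

section Invariants

variable {G : Type u} [Group G] [TopologicalSpace G] [IsTopologicalGroup G] [CompactSpace G]
variable {A : Type u} [AddCommGroup A] [DistribMulAction G A] [TopologicalSpace A]
  [DiscreteTopology A]
variable (hA : ∀ a : A, IsOpen {g : G | g • a = a}) (H : Subgroup G)

/-- **A `G`-invariant element of `M_G^H(A)` is a constant function**: `(x • f)(1) = f(x)`.
[cite: SerreGaloisCohomology1997, I §2.5] -/
theorem coe_apply_eq_apply_one_of_mem_invariants (f : coindModule (subRep hA H))
    (hf : f ∈ (coindRep (subRep hA H)).toTopRep.ρ.invariants) (x : G) :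
    (f : C(G, A)) x = (f : C(G, A)) 1 := by
  have h := congrArg (fun m : coindModule (subRep hA H) ↦ (m : C(G, A)) 1) (hf x)
  change ((coindRep (subRep hA H) x f : coindModule (subRep hA H)) : C(G, A)) 1 = (f : C(G, A)) 1
    at h
  rw [coindRep_apply_apply, one_mul] at h
  exact h

/-- **… whose value lies in `A^H`**: `f(h) = h • f(1)` and `f(h) = f(1)`.
[cite: SerreGaloisCohomology1997, I §2.5] -/
theorem smul_apply_one_of_mem_invariants (f : coindModule (subRep hA H))
    (hf : f ∈ (coindRep (subRep hA H)).toTopRep.ρ.invariants) (h : H) :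
    (h : G) • (f : C(G, A)) 1 = (f : C(G, A)) 1 := by
  have e := coind_apply_mul hA H f h 1
  rw [mul_one, coe_apply_eq_apply_one_of_mem_invariants hA H f hf (h : G)] at e
  exact e.symm

/-- **The constant element of `M_G^H(A)` with value `a ∈ A^H`.** A definition (plumbing).
[cite: SerreGaloisCohomology1997, I §2.5] -/
def constCoind (a : A) (ha : ∀ h : H, (h : G) • a = a) : coindModule (subRep hA H) :=
  ⟨ContinuousMap.const G a, fun h x ↦ by
    change a = (h : G) • a
    exact (ha h).symm⟩

omit [CompactSpace G] in
/-- Unfolding `constCoind`. [folklore] -/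
@[simp] theorem constCoind_apply (a : A) (ha : ∀ h : H, (h : G) • a = a) (x : G) :
    ((constCoind hA H a ha : coindModule (subRep hA H)) : C(G, A)) x = a := rfl

/-- The constant elements are `G`-invariant. [cite: SerreGaloisCohomology1997, I §2.5] -/
theorem constCoind_mem_invariants (a : A) (ha : ∀ h : H, (h : G) • a = a) :
    constCoind hA H a ha ∈ (coindRep (subRep hA H)).toTopRep.ρ.invariants := by
  intro g
  change coindRep (subRep hA H) g (constCoind hA H a ha) = constCoind hA H a ha
  refine Subtype.ext (ContinuousMap.ext fun x ↦ ?_)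
  rw [coindRep_apply_apply, constCoind_apply, constCoind_apply]

/-- An invariant IS the constant element on its value at `1`. [folklore] -/
theorem eq_constCoind_of_mem_invariants (f : coindModule (subRep hA H))
    (hf : f ∈ (coindRep (subRep hA H)).toTopRep.ρ.invariants) :
    f = constCoind hA H ((f : C(G, A)) 1) (smul_apply_one_of_mem_invariants hA H f hf) :=
  Subtype.ext (ContinuousMap.ext fun x ↦ by
    rw [constCoind_apply, coe_apply_eq_apply_one_of_mem_invariants hA H f hf x])

variable (γ : G) [H.Normal]

/-- **On invariants, `S_γ − 1` is `a ↦ γ⁻¹ • a − a`** (value at `1`).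
[cite: JetchevSkinnerWan2017, Lemma 3.3.3 (arXiv:1512.06894 p. 11)] -/
theorem tHom_apply_one_of_mem_invariants (f : coindModule (subRep hA H))
    (hf : f ∈ (coindRep (subRep hA H)).toTopRep.ρ.invariants) :
    (((tHom hA H γ).hom f : coindModule (subRep hA H)) : C(G, A)) 1 =
      γ⁻¹ • (f : C(G, A)) 1 - (f : C(G, A)) 1 := by
  rw [tHom_apply_apply, mul_one, coe_apply_eq_apply_one_of_mem_invariants hA H f hf γ]

/-- `(S_γ − 1)(const a) = const (γ⁻¹ • a − a)` pointwise. [folklore] -/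
theorem tHom_constCoind_apply (a : A) (ha : ∀ h : H, (h : G) • a = a) (x : G) :
    (((tHom hA H γ).hom (constCoind hA H a ha) : coindModule (subRep hA H)) : C(G, A)) x =
      γ⁻¹ • a - a := by
  rw [tHom_apply_apply, constCoind_apply, constCoind_apply]

omit [TopologicalSpace G] [IsTopologicalGroup G] [CompactSpace G] [TopologicalSpace A]
  [DiscreteTopology A] in
/-- `γ⁻¹ • a ∈ A^H` for `a ∈ A^H` (`H` normal). [folklore] -/
theorem smul_inv_mem_fixed {a : A} (ha : ∀ h : H, (h : G) • a = a) (h : H) :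
    (h : G) • (γ⁻¹ • a) = γ⁻¹ • a := by
  have hmem : γ * (h : G) * γ⁻¹ ∈ H := Subgroup.Normal.conj_mem inferInstance (h : G) h.2 γ
  have e : (h : G) • (γ⁻¹ • a) = γ⁻¹ • ((γ * (h : G) * γ⁻¹) • a) := by
    rw [smul_smul, smul_smul]
    congr 1
    group
  rw [e, ha ⟨_, hmem⟩]

/-- **The endomorphism `γ⁻¹ − 1` of `A^H`** (as an additive subgroup `{a | ∀ h ∈ H, h • a = a}`).
A definition (plumbing). [cite: GreenbergLNM1716, §3 proof of Lemma 3.3 (p. 87)] -/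
def fixedSubgroup : AddSubgroup A where
  carrier := {a | ∀ h : H, (h : G) • a = a}
  zero_mem' := fun h ↦ smul_zero _
  add_mem' := fun {a b} ha hb h ↦ by rw [smul_add, ha h, hb h]
  neg_mem' := fun {a} ha h ↦ by rw [smul_neg, ha h]

omit [TopologicalSpace G] [IsTopologicalGroup G] [CompactSpace G] [TopologicalSpace A]
  [DiscreteTopology A] [H.Normal] in
/-- Membership in `A^H`. [folklore] -/
theorem mem_fixedSubgroup_iff (a : A) : a ∈ fixedSubgroup (A := A) H ↔ ∀ h : H, (h : G) • a = a :=
  Iff.rfl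

/-- **`γ⁻¹ − 1 : A^H → A^H`.** A definition (plumbing).
[cite: GreenbergLNM1716, §3 proof of Lemma 3.3 (p. 87)] -/
def subOneFixed : fixedSubgroup (A := A) H →+ fixedSubgroup (A := A) H where
  toFun a := ⟨γ⁻¹ • (a : A) - a, fun h ↦ by
    rw [smul_sub, smul_inv_mem_fixed H γ a.2 h, a.2 h]⟩
  map_zero' := Subtype.ext (by simp)
  map_add' a b := Subtype.ext (by
    change γ⁻¹ • ((a : A) + b) - (a + b) = (γ⁻¹ • (a : A) - a) + (γ⁻¹ • (b : A) - b)
    rw [smul_add]; abel)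

omit [TopologicalSpace G] [IsTopologicalGroup G] [CompactSpace G] [TopologicalSpace A]
  [DiscreteTopology A] in
/-- Unfolding `subOneFixed`. [folklore] -/
@[simp] theorem coe_subOneFixed_apply (a : fixedSubgroup (A := A) H) :
    ((subOneFixed H γ a : fixedSubgroup (A := A) H) : A) = γ⁻¹ • (a : A) - a := rfl

end Invariants

/-! ## 2. The kernel of restriction is the image of `δ₀`; `A^H/(γ⁻¹ − 1)A^H ≃ ker res` -/

section Kernel

variable {G : Type u} [Group G] [TopologicalSpace G] [IsTopologicalGroup G] [CompactSpace G]
  [T2Space G] [TotallyDisconnectedSpace G]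
variable {A : Type u} [AddCommGroup A] [DistribMulAction G A] [TopologicalSpace A]
  [DiscreteTopology A]
variable (hA : ∀ a : A, IsOpen {g : G | g • a = a})
variable {p : ℕ} [Fact p.Prime] (κ : G →ₜ* Multiplicative ℤ_[p]) (hκ : Surjective κ)
  {γ : G} (hγ : κ γ = Multiplicative.ofAdd 1) (hAt : IsPrimaryTorsion p A)

/-- **`ker (res : H¹(G, A) → H¹(H, A)) = im δ₀`** for `H = ker κ`: `res = sh ∘ H¹(unit)` with `sh`
injective, and the long exact sequence of `0 → A → M_G^H(A) → M_G^H(A) → 0` is exact at `H¹(G, A)`.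
[cite: SerreGaloisCohomology1997, I §2.2 and I §2.5 Prop. 10] -/
theorem resSubgroup_eq_zero_iff_exists_δ₀ (z : continuousCohomology 1 (discreteRep hA).toTopRep) :
    ResKernel.resSubgroup (kerK κ) A (z : discreteH1 G A) = 0 ↔
      ∃ v, (isSES_unit_tHom hA κ hκ hγ hAt).δ₀ v = z := by
  constructor
  · intro hz
    have h1 : cohomologyMap (unitHom hA (kerK κ)) 1 z = 0 := by
      apply (injective_iff_map_eq_zero _).1 (sh_injective hA (kerK κ) (isClosed_kerK κ))
      rw [sh_cohomologyMap_unitHom, hz]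
    exact (isSES_unit_tHom hA κ hκ hγ hAt).exists_δ₀_eq_of_map_one_eq_zero z h1
  · rintro ⟨v, rfl⟩
    rw [← sh_cohomologyMap_unitHom, (isSES_unit_tHom hA κ hκ hγ hAt).map_one_δ₀, map_zero]

/-- The constant invariant of `M_G^H(A)` on `a ∈ A^H` (bundled). A definition (plumbing). [folklore] -/
def constFixed (a : fixedSubgroup (A := A) (kerK κ)) :
    (coindRep (subRep hA (kerK κ))).toTopRep.ρ.invariants :=
  ⟨constCoind hA (kerK κ) (a : A) ((mem_fixedSubgroup_iff (kerK κ) (a : A)).mp a.2),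
    constCoind_mem_invariants hA (kerK κ) (a : A) ((mem_fixedSubgroup_iff (kerK κ) (a : A)).mp a.2)⟩

omit [T2Space G] [TotallyDisconnectedSpace G] in
/-- Unfolding `constFixed` pointwise. [folklore] -/
@[simp] theorem constFixed_apply (a : fixedSubgroup (A := A) (kerK κ)) (x : G) :
    (((constFixed hA κ a : (coindRep (subRep hA (kerK κ))).toTopRep.ρ.invariants) :
      coindModule (subRep hA (kerK κ))) : C(G, A)) x = a := rfl

omit [T2Space G] [TotallyDisconnectedSpace G] in
/-- `constFixed` is additive. [folklore] -/
theorem constFixed_add (a b : fixedSubgroup (A := A) (kerK κ)) :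
    constFixed hA κ (a + b) = constFixed hA κ a + constFixed hA κ b :=
  Subtype.ext (Subtype.ext (ContinuousMap.ext fun _ ↦ rfl))

omit [T2Space G] [TotallyDisconnectedSpace G] in
/-- `constFixed 0 = 0`. [folklore] -/
theorem constFixed_zero : constFixed hA κ (0 : fixedSubgroup (A := A) (kerK κ)) = 0 :=
  Subtype.ext (Subtype.ext (ContinuousMap.ext fun _ ↦ rfl))

/-- **The map `A^H → ker res`, `a ↦ δ₀(const a)`** (the inflation of the cocycle `γ ↦ a` on
`G/H ≅ ℤ_p`, in the long-exact-sequence presentation). A definition.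
[cite: GreenbergLNM1716, §3 proof of Lemma 3.3 (p. 87)] -/
def deltaFixed : fixedSubgroup (A := A) (kerK κ) →+
    (ResKernel.resSubgroup (kerK κ) A).ker where
  toFun a := ⟨((isSES_unit_tHom hA κ hκ hγ hAt).δ₀ (constFixed hA κ a) :
        continuousCohomology 1 (discreteRep hA).toTopRep),
    (AddMonoidHom.mem_ker).mpr ((resSubgroup_eq_zero_iff_exists_δ₀ hA κ hκ hγ hAt _).mpr ⟨_, rfl⟩)⟩
  map_zero' := by
    apply Subtype.ext
    change (isSES_unit_tHom hA κ hκ hγ hAt).δ₀ (constFixed hA κ 0) = 0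
    rw [constFixed_zero, map_zero]
  map_add' a b := by
    apply Subtype.ext
    change (isSES_unit_tHom hA κ hκ hγ hAt).δ₀ (constFixed hA κ (a + b)) =
      (isSES_unit_tHom hA κ hκ hγ hAt).δ₀ (constFixed hA κ a) +
        (isSES_unit_tHom hA κ hκ hγ hAt).δ₀ (constFixed hA κ b)
    rw [constFixed_add, map_add]

/-- Unfolding `deltaFixed` (as a class of `H¹(G, A)`). [folklore] -/
theorem coe_deltaFixed_apply (a : fixedSubgroup (A := A) (kerK κ)) :
    ((deltaFixed hA κ hκ hγ hAt a : (ResKernel.resSubgroup (kerK κ) A).ker) : discreteH1 G A) =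
      (isSES_unit_tHom hA κ hκ hγ hAt).δ₀ (constFixed hA κ a) := rfl

/-- **`deltaFixed` is onto `ker res`**: a class in the kernel is `δ₀ v`, and the invariant `v` is
the constant element on `v(1) ∈ A^H`. [cite: SerreGaloisCohomology1997, I §2.2] -/
theorem deltaFixed_surjective : Surjective (deltaFixed hA κ hκ hγ hAt) := by
  rintro ⟨z, hz⟩
  obtain ⟨v, hv⟩ := (resSubgroup_eq_zero_iff_exists_δ₀ hA κ hκ hγ hAt z).mp
    ((AddMonoidHom.mem_ker).mp hz)
  refine ⟨⟨((v : coindModule (subRep hA (kerK κ))) : C(G, A)) 1,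
    (mem_fixedSubgroup_iff (kerK κ) _).mpr (smul_apply_one_of_mem_invariants hA (kerK κ) v.1 v.2)⟩,
    ?_⟩
  apply Subtype.ext
  change (isSES_unit_tHom hA κ hκ hγ hAt).δ₀ (constFixed hA κ _) = z
  rw [← hv]
  congr 1
  exact Subtype.ext (eq_constCoind_of_mem_invariants hA (kerK κ) v.1 v.2).symm

/-- **`δ₀(const a) = 0 ↔ a ∈ (γ⁻¹ − 1)A^H`** (exactness at `M^G`: `δ₀ v = 0` iff `v` lifts to an
invariant `w` of `M`, i.e. to a constant `const b`, `b ∈ A^H`, with `(S_γ − 1)(const b) = const a`,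
i.e. `γ⁻¹ • b − b = a`). [cite: SerreGaloisCohomology1997, I §2.2]
[cite: GreenbergLNM1716, §3 proof of Lemma 3.3 (p. 87)] -/
theorem deltaFixed_eq_zero_iff (a : fixedSubgroup (A := A) (kerK κ)) :
    deltaFixed hA κ hκ hγ hAt a = 0 ↔ a ∈ (subOneFixed (kerK κ) γ).range := by
  have key : deltaFixed hA κ hκ hγ hAt a = 0 ↔
      (isSES_unit_tHom hA κ hκ hγ hAt).δ₀ (constFixed hA κ a) = 0 := by
    rw [← Subtype.coe_inj, coe_deltaFixed_apply]
    rfl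
  rw [key, (isSES_unit_tHom hA κ hκ hγ hAt).δ₀_eq_zero_iff]
  constructor
  · rintro ⟨w, hw, hwa⟩
    refine ⟨⟨((w : coindModule (subRep hA (kerK κ))) : C(G, A)) 1,
      (mem_fixedSubgroup_iff (kerK κ) _).mpr (smul_apply_one_of_mem_invariants hA (kerK κ) w hw)⟩,
      Subtype.ext ?_⟩
    rw [coe_subOneFixed_apply]
    change γ⁻¹ • ((w : coindModule (subRep hA (kerK κ))) : C(G, A)) 1 -
      ((w : coindModule (subRep hA (kerK κ))) : C(G, A)) 1 = (a : A)
    rw [← tHom_apply_one_of_mem_invariants hA (kerK κ) γ w hw]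
    exact congrArg (fun m : coindModule (subRep hA (kerK κ)) ↦ (m : C(G, A)) 1) hwa
  · rintro ⟨b, hb⟩
    refine ⟨constCoind hA (kerK κ) (b : A) ((mem_fixedSubgroup_iff (kerK κ) (b : A)).mp b.2),
      constCoind_mem_invariants hA (kerK κ) _ _, ?_⟩
    refine Subtype.ext (ContinuousMap.ext fun x ↦ ?_)
    rw [tHom_constCoind_apply]
    change γ⁻¹ • (b : A) - b = ((a : fixedSubgroup (A := A) (kerK κ)) : A)
    rw [← hb]
    rfl

/-- **`ker res ≃ A^H/(γ⁻¹ − 1)A^H`** — the kernel of `H¹(G, A) → H¹(H, A)` (`H = ker(κ : G ↠ ℤ_p)`,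
`κ(γ) = 1`, `A` discrete `p`-primary, `G` profinite) is `A^H` modulo `γ⁻¹ − 1`: the inflation part
of inflation–restriction together with `H¹(ℤ_p, B) = B/(γ − 1)B` for the procyclic quotient
(Greenberg: "`ker(r_v) ≅ H¹(Γ_v, B_v)`, `Γ_v` topologically cyclic, so `H¹(Γ_v, B_v) = B_v/(γ_v−1)B_v`").
[cite: GreenbergLNM1716, §3 proof of Lemma 3.3 (p. 87)] [cite: SerreGaloisCohomology1997, XIII §1] -/
def kerResEquiv :
    fixedSubgroup (A := A) (kerK κ) ⧸ (subOneFixed (kerK κ) γ).range ≃+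
      (ResKernel.resSubgroup (kerK κ) A).ker :=
  (QuotientAddGroup.quotientAddEquivOfEq (by
      ext a
      rw [AddMonoidHom.mem_ker]
      exact (deltaFixed_eq_zero_iff hA κ hκ hγ hAt a).symm)).trans
    (QuotientAddGroup.quotientKerEquivOfSurjective (deltaFixed hA κ hκ hγ hAt)
      (deltaFixed_surjective hA κ hκ hγ hAt))

include hA hκ hγ hAt in
/-- **Counting form: `#ker (H¹(G, A) → H¹(H, A)) = #(A^H/(γ⁻¹ − 1)A^H)`** (as `Nat.card`, with no
finiteness assumption: both sides are `0` when infinite). Route p2's `finite_localKer_and_natCard_le`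
is the inequality `≤` of this identity at a decomposition group; here EQUALITY.
[cite: GreenbergLNM1716, §3 proof of Lemma 3.3 (p. 87)] -/
theorem natCard_ker_resSubgroup_eq :
    Nat.card (ResKernel.resSubgroup (kerK κ) A).ker =
      Nat.card (fixedSubgroup (A := A) (kerK κ) ⧸ (subOneFixed (kerK κ) γ).range) :=
  (Nat.card_congr (kerResEquiv hA κ hκ hγ hAt).toEquiv).symm

end Kernel

end Summit.BirchSwinnertonDyer.Rank1Residual.X11b.ProcyclicDescent

end
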